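import Summits.QuantumFields.YangMills.Theorems.BalabanUVNodesN12AtRecord12ExistsCurrency
import Literature.MathematicalPhysics.QuantumFieldTheory.Balaban1983to89.B15LeafKnitMassSel
import Literature.MathematicalPhysics.QuantumFieldTheory.Balaban1983to89.Node00.Record12ResidualsSlots

/-!
# BalabanUVNodes ∕ N12 AT THE STAGE-12 W-PINNED RECORD ON PRINT'S MASS PROVISO — the `∀ s` positive-mass display is UNSATISFIABLE wherever the (2.18)
# index of record has an absent sequence (census), and the Stage-12 ∃-currency ∕ ∀-form ∕ `stub_nodes12`-currency closers RE-CUT on *«the denominators are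
# positive»* ([IV] p.176 ll.14–16: `hmassSel ∧ hfib` of the N12 s3 seat's `B15LeafKnitMassSel`)
# (sequel of `BalabanUVNodesN12AtRecord12ExistsCurrency`; Track A, DAG node N12 = [B15, Balaban1989LargeFieldI] CMP 122 (1989) 175; cluster K1′ `StabilityBAtRecordR12e` =
# stmt-QuantumFields-19903 (rev 15; registered stubs `stub_nodes12` ∕ `stub_betaWindow12`); seat `pub-ymgap-dag-n12-d` g3 (R134 s2), 2026-08-26; count-neutral, NOT a discharge)

HONEST FRAMING.  Count-neutral kernel BOOKKEEPING BY NAME over landed modules; nothing of Bałaban's asserted; N12 NOT discharged.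
WHY THIS FILE (a located typing-strength finding ON THIS SEAT'S OWN g0 ∕ g2 FILES, with its repair).  Every N12 closer keyed on node00-def g30's display structure
`Node00.WDisplays₁₀ θ λ P` — its field `hmass : ∀ s, 0 < ∫dV t_s` over the WHOLE (2.18) index of record at level `λ.kSel P + 1` — and every `…_of_mass` ∃-currency
theorem of this seat (p452875, p466956 §2–§4) is VACUOUS at any (run, step) whose index carries an ABSENT sequence (one outside the image of n02-b's index map
`σOfRecord`; print: a pair `(Ω_{k+1}, Λ_{k+1})` no label `(P, Q, R, S)` of (3.2)–(3.21) [III] produces): node00-def-K0b's `Node00.slotsTOfRecord_succ_eq_zero_of_forall_ne`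
makes its pre-𝐑 slot the ZERO density, so the term `t_s = χ_k(s)·0` has mass `0` (§2, kernel).  The same species bears on K0′'s row P12 `SlotsNondegenerate` at the identity
selector.  REPAIR (the N12 s3 seat's module 6 `B15LeafKnitMassSel`, p467339): print's proviso constrains the selector's RANGE only — `hmassSel : ∀ s, 0 < ∫dV t_{ppSel s}`
plus one fibre witness per denominator `hfib : ∀ s, ∃ s′, ppSel s′ = ppSel s ∧ 0 < ∫dV t_{s′}` (immediate at an idempotent selector, print's `(Z″)″ = Z″`).
* §1 LEAF-KEYED pointed closers at all five node00-def g32 views (`…_of_leaf`: hypothesis `B15Leaf (WOfRecord₁₂ θ λ P)`) and the ∀-form `s_N12_of_refines₁₂CB10YZW_of_leaf`.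
* §2 CENSUS (A2): `rterm_reprTOfRecord₁₀_eq_zero_of_absent`, `not_forall_mass_pos_of_absent`, `not_wDisplays₁₀_of_absent` (an absent sequence at level `λ.kSel P + 1`
  ⇒ `¬ WDisplays₁₀ θ λ P` for EVERY layer `λ` with that step), `not_forall_massSel_pos_of_absent_mem_range` (the repaired display fails exactly when the SELECTOR'S RANGE
  meets an absent sequence — e.g. at the identity selector).
* §3 Stage-9 generic: `b15Leaf_WOfRecord₁₀_pinAll_of_deg_massSel` — the [IV] leaf at the triply pinned layer `(λ.pinRPrime θ).pinD189 θ σ` of `N12ResidWPinnedLayer` from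
  `θ.Provisos₁₀` + the degenerate-run support provisos + `hmassSel` + `hfib` + Proposition 1 at `λ.LF P` + (1.80) at `σ.dev0` + (1.89) at `D189OfRecord θ P (σ P)`
  (n12-e's `b15Leaf_WOfRecord₁₀_of_massSel(_supp)` BY NAME, pin equation `rfl`); corners `…_of_not_new189` (junk situation: (1.80) ∕ (1.89) cost nothing) and
  `…_of_idem` (`hfib` discharged at an idempotent selector).
* §4 the Stage-12 ∃-currency RE-CUT: `exists_world₁₂CB10YZW_b15_main_pinAll_of_massSel`, census `…_pinAll_junkSit_of_massSel`, ∀-form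
  `s_N12_of_refines₁₂CB10YZW_of_pinAll_deg_massSel` (the ₁₂C-rebind twin of p466956 §4 follows the same way and is left out for length).
* §5 IN `stub_nodes12`'s CURRENCY (plan g64 `K1Skeleton12`: `NodesAtSomeRecord12` is keyed on def-T's `IsRecordOfRecord₁₂C`): `exists_world₁₂C_b15_main_pinAll_of_massSel` —
  the same world, ₁₂C-keyed through g32's `isRecordOfRecord₁₂C_of_isRecordOfRecord₁₂CB10YZW`, with `θ`, `h`, floor, operator layer, `ζ` and the view equation EXPOSED so
  the other twelve nodes' closers apply at the SAME world (the unity guard `θ.ZtUnity ∧ θ.SlotsNondegenerate` rides on `θ` untouched).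
WHAT N12 THEN COSTS in K1′'s ∃-currency (typing strength, count-neutral, NOT a second gap): `hmassSel ∧ hfib` (positive mass of the OCCURRING denominators of `𝐓ρ_k` —
NODE 00; with K0′'s `SlotsNondegenerate` the same species, not the same statement: non-vanishing of a slot is not positivity of its mass), the support provisos on runs
whose step is not below `K`, [IV] Proposition 1 at the carrier the assembly pins, (1.80) + (1.89) at the N12 s3 seat's letters of record (void at a junk situation —
`Sit189OfRecord` not in the tree); (1.102) nothing.  NOT CONSUMABLE HERE (located, n12-e's (L1)): `B15Claim189FlowAtRecord.claim189_D189OfRecord_of_leaves` reads the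
run's `smallCouplings` ∕ `betaSmoothBounded` leaves, which are not antecedents of `Dag.B15_main` (`b5 b7 b8 b10 b11`).  One finite four-torus programme at fixed `ε`;
nothing continuum ∕ ℝ⁴ ∕ OS ∕ mass gap ∕ Clay.  0 `sorry`, 0 `def`, standard axioms.  Filed `--supports` K1′ (stmt-QuantumFields-19903) `--as helper`.
Sources: [Balaban1989LargeFieldI] (0.2)–(0.6) p.176, Prop. 1 p.194, (1.80), (1.89), (1.99)–(1.102); [Balaban1988Convergent] (2.17)–(2.18) p.257, §3 pp.265–270; [Balaban1989LargeFieldII] Thm 1.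
-/

noncomputable section

open MeasureTheory

namespace Summit.QuantumFields.YangMills.BalabanUVNodes.N12AtRecord12MassSel

open Literature.MathematicalPhysics.QuantumFieldTheory.Balaban1983to89
open Literature.MathematicalPhysics.QuantumFieldTheory.Balaban1983to89.T4Continuum (T4Family FiniteEpsData)
open Literature.MathematicalPhysics.QuantumFieldTheory.Balaban1983to89.DagBinding (WorldP leavesP PrintedCarriers15 B15Leaf)
open Literature.MathematicalPhysics.QuantumFieldTheory.Balaban1983to89.Node00
open B15Claim189Assembly (Setting189 new189 chiPP dom)
open B15Sect1Statements (RPrimeData Normalization1102 rPrime1100)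
open B15 (LFVar Prop1Printed Ineq180)
open B15.BasicStep (Claim189)
open B8Eq17ClassAkV1 (plaqsOf)
open B15Claim189PinAtRecord (D189OfRecord)
open B15RPrime1100OfRep (rPrimeDataOfSel)
open B15LeafKnitMassSel (b15Leaf_WOfRecord₁₀_of_massSel b15Leaf_WOfRecord₁₀_of_massSel_supp fibreWitness_of_idem)
open YMDAG.UVSplit (RecordPred Datum AtRecord S_N12)
open Summit.QuantumFields.YangMills.BalabanUVNodes.N12ResidWPinnedLayer (exists_residW_pinLF_printedDisplays exists_sit189_not_new189)

variable {N : ℕ} [NeZero N]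

/-! ## §1 LEAF-KEYED POINTED CLOSERS at the five Stage-12 views, and the ∀-form — the socket for every mass-proviso variant -/

section LeafClosers
variable {F : T4Family} {w : WorldP}

/-- **POINTED CLOSER, four-pin view, LEAF-KEYED**: a world bound at run `P` over `θ.view₁₂B10YZW Mstar ops ζ λ` satisfies `Dag.B15_main` at `P` as soon as the [IV]
LEAF holds at the bundle of record `WOfRecord₁₂ θ λ P` (in-edges unused; `b15_main_of_up_view₁₂B10YZW_of_displays` is this ∘ g30's `b15Leaf_WOfRecord₁₀_of_displays`).
[cite: Balaban1989LargeFieldI, Prop. 1 (1.78) p.194, (0.2)–(0.6) p.176, (1.80) p.195, (1.89) p.198, (1.102) p.201] -/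
theorem b15_main_of_up_view₁₂B10YZW_of_leaf (θ : Stage12Params F N) (Mstar : ℕ) (ops : OpsY N θ.toStage3Params Mstar) (ζ : ResidZ F N)
    (lamW : ResidW F N) {P : B12.RunParams} (hup : w.up P = upOfRecord₅C F N (θ.view₁₂B10YZW F N Mstar ops ζ lamW) P)
    (hleaf : B15Leaf (WOfRecord₁₂ F N θ lamW P)) : Dag.B15_main (leavesP w P) := by
  intro _ _ _ _ _
  show (w.up P).rBasicStep
  rw [hup]
  exact (upOfRecord₅C_view₁₂B10YZW_leaves F N θ Mstar ops ζ lamW P).1.2 hleaf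

/-- **POINTED CLOSER, five-pin view, LEAF-KEYED** (S-binding). [cite: Balaban1989LargeFieldI, Prop. 1 (1.78) p.194, (0.2)–(0.6) p.176, (1.80) p.195, (1.89) p.198, (1.102) p.201] -/
theorem b15_main_of_up_view₁₂B8B10YZW_of_leaf (θ : Stage12Params F N) (lam : ResidB8 θ.toStage3Params) (Mstar : ℕ) (ops : OpsY N θ.toStage3Params Mstar)
    (ζ : ResidZ F N) (lamW : ResidW F N) {P : B12.RunParams} (hup : w.up P = upOfRecord₅CS F N (θ.view₁₂B8B10YZW F N lam Mstar ops ζ lamW) P)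
    (hleaf : B15Leaf (WOfRecord₁₂ F N θ lamW P)) : Dag.B15_main (leavesP w P) := by
  intro _ _ _ _ _
  show (w.up P).rBasicStep
  rw [hup]
  exact (upOfRecord₅CS_view₁₂B8B10YZW_leaves F N θ lam Mstar ops ζ lamW P).2.1.2 hleaf

/-- **POINTED CLOSER, six-pin view with [B12], LEAF-KEYED** (S-binding). [cite: Balaban1989LargeFieldI, Prop. 1 (1.78) p.194, (0.2)–(0.6) p.176, (1.80) p.195, (1.89) p.198, (1.102) p.201] -/
theorem b15_main_of_up_view₁₂B12B8B10YZW_of_leaf (θ : Stage12Params F N) (lam12 : ResidB12 F N θ.τ9.M) (lam : ResidB8 θ.toStage3Params) (Mstar : ℕ)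
    (ops : OpsY N θ.toStage3Params Mstar) (ζ : ResidZ F N) (lamW : ResidW F N) {P : B12.RunParams}
    (hup : w.up P = upOfRecord₅CS F N (θ.view₁₂B12B8B10YZW F N lam12 lam Mstar ops ζ lamW) P) (hleaf : B15Leaf (WOfRecord₁₂ F N θ lamW P)) :
    Dag.B15_main (leavesP w P) := by
  intro _ _ _ _ _
  show (w.up P).rBasicStep
  rw [hup]
  exact (upOfRecord₅CS_view₁₂B12B8B10YZW_leaves F N θ lam12 lam Mstar ops ζ lamW P).2.2.1.2 hleaf

/-- **POINTED CLOSER, five-pin view with [B8′], LEAF-KEYED** (S-binding). [cite: Balaban1989LargeFieldI, Prop. 1 (1.78) p.194, (0.2)–(0.6) p.176, (1.80) p.195, (1.89) p.198, (1.102) p.201] -/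
theorem b15_main_of_up_view₁₂B8subB10YZW_of_leaf (θ : Stage12Params F N) (lam : ResidB8 θ.toStage3Params) (Mstar : ℕ) (ops : OpsY N θ.toStage3Params Mstar)
    (ζ : ResidZ F N) (lamW : ResidW F N) {P : B12.RunParams} (hup : w.up P = upOfRecord₅CS F N (θ.view₁₂B8subB10YZW F N lam Mstar ops ζ lamW) P)
    (hleaf : B15Leaf (WOfRecord₁₂ F N θ lamW P)) : Dag.B15_main (leavesP w P) := by
  intro _ _ _ _ _
  show (w.up P).rBasicStep
  rw [hup]
  exact (upOfRecord₅CS_view₁₂B8subB10YZW_leaves F N θ lam Mstar ops ζ lamW P).2.1.2 hleaf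

/-- **POINTED CLOSER, six-pin view with [B12] and [B8′], LEAF-KEYED** (S-binding). [cite: Balaban1989LargeFieldI, Prop. 1 (1.78) p.194, (0.2)–(0.6) p.176, (1.80) p.195, (1.89) p.198, (1.102) p.201] -/
theorem b15_main_of_up_view₁₂B12B8subB10YZW_of_leaf (θ : Stage12Params F N) (lam12 : ResidB12 F N θ.τ9.M) (lam : ResidB8 θ.toStage3Params) (Mstar : ℕ)
    (ops : OpsY N θ.toStage3Params Mstar) (ζ : ResidZ F N) (lamW : ResidW F N) {P : B12.RunParams}
    (hup : w.up P = upOfRecord₅CS F N (θ.view₁₂B12B8subB10YZW F N lam12 lam Mstar ops ζ lamW) P) (hleaf : B15Leaf (WOfRecord₁₂ F N θ lamW P)) :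
    Dag.B15_main (leavesP w P) := by
  intro _ _ _ _ _
  show (w.up P).rBasicStep
  rw [hup]
  exact (upOfRecord₅CS_view₁₂B12B8subB10YZW_leaves F N θ lam12 lam Mstar ops ζ lamW P).2.2.1.2 hleaf

/-- **`S_N12 Rec` FOR EVERY RECORD PREDICATE REFINING THE STAGE-12 W-PINNED RECORD, FROM THE LEAF AT THE PRESENTING PACKAGES** (leaf-keyed twin of
`N12AtRecord12CB10YZW.s_N12_of_refines₁₂CB10YZW_of_displays`; in-edges unused).  NOT-A-DISCHARGE. [cite: Balaban1989LargeFieldI, Prop. 1 (1.78) p.194, (0.2)–(0.6) p.176, (1.80) p.195, (1.89) p.198, (1.102) p.201] -/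
theorem s_N12_of_refines₁₂CB10YZW_of_leaf (Rec : RecordPred N)
    (href : ∀ (F : T4Family) (D : Datum F N) (w : WorldP), Rec F D w → IsRecordOfRecord₁₂CB10YZW F N D w)
    (hleaf : ∀ (F : T4Family) (D : Datum F N) (w : WorldP), Rec F D w →
      ∀ (θ : Stage12Params F N) (hP : θ.Provisos₁₂ F N) (Mstar : ℕ) (ops : OpsY N θ.toStage3Params Mstar) (ζ : ResidZ F N) (lamW : ResidW F N),
        θ.Admissible F N → D = datumOfRecord₁₂ F N θ hP → (∀ P, w.up P = upOfRecord₅C F N (θ.view₁₂B10YZW F N Mstar ops ζ lamW) P) →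
          ∀ P : B12.RunParams, B15Leaf (WOfRecord₁₂ F N θ lamW P)) :
    S_N12 Rec :=
  fun F D w hR P => N12AtRecord12CB10YZW.b15_main_of_isRecordOfRecord₁₂CB10YZW_of_slots (href F D w hR) (hleaf F D w hR) P

end LeafClosers

/-! ## §2 CENSUS (A2) — the `∀ s` positive-mass display is UNSATISFIABLE wherever the index of record has an absent sequence -/

section Absent
variable {F : T4Family} {θ : Stage9Params F N}

/-- **AN ABSENT SEQUENCE CARRIES THE ZERO TERM**: at run `P`, step `k`, a length-`(k+1)` sequence of record outside the image of n02-b's index map `σOfRecord` has the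
ZERO pre-𝐑 term `t_s = χ_{k+1}(s) · (𝐓e^A)(s) = χ · 0` in `Tstep rep_k` of the tower of record (node00-def-K0b's `slotsTOfRecord_succ_eq_zero_of_forall_ne`: its step
weight is an empty resummation). [cite: Balaban1988Convergent, (2.17)–(2.18) p.257, (3.5) p.265, (3.20) p.269, (3.24)–(3.25) p.270] -/
theorem rterm_reprTOfRecord₁₀_eq_zero_of_absent (P : B12.RunParams) (k : ℕ) (s : SeqOfRecord F θ.ν θ.τ9.M (gOfRecord₁₀ F N θ P) P.K (k + 1))
    (hs : ∀ t : LbOfRecord F θ.ν P (gOfRecord₁₀ F N θ P) k, σOfRecord F θ.ν θ.τ9.M P (gOfRecord₁₀ F N θ P) k s.init t ≠ s) :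
    rterm (reprTOfRecord₁₀ F N θ P k) s = 0 := by
  funext V
  show chiSeqOfRecord F N θ.ν θ.τ9.M (gOfRecord₁₀ F N θ P) P.K (k + 1) s V *
      slotsTOfRecord F N θ.ν θ.τ9 (EOfRecord₁₀ F N θ) (wOfRecord F N θ.ν θ.τ9.M θ.A₁ θ.ζ) θ.ppSel P (gOfRecord₁₀ F N θ P) (k + 1) s V = 0
  rw [slotsTOfRecord_succ_eq_zero_of_forall_ne F N θ.ν θ.A₁ θ.τ9 θ.ζ (EOfRecord₁₀ F N θ) θ.ppSel P (gOfRecord₁₀ F N θ P) k s hs]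
  exact mul_zero _

/-- **… SO THE `∀ s` POSITIVE-MASS DISPLAY FAILS at every (run, step) whose index carries an absent sequence** (the display of g30's `WDisplays₁₀.hmass`, n12-a's
`b15Leaf_WOfTower9_of_mass`, and this seat's `…_of_mass` ∃-currency theorems — all VACUOUS there). [cite: Balaban1989LargeFieldI, (0.2)–(0.3) p.176, p.176 ll.14–16; Balaban1988Convergent, (2.17)–(2.18) p.257 (bookkeeping census)] -/
theorem not_forall_mass_pos_of_absent (P : B12.RunParams) (k : ℕ)
    (hex : ∃ s : SeqOfRecord F θ.ν θ.τ9.M (gOfRecord₁₀ F N θ P) P.K (k + 1),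
      ∀ t : LbOfRecord F θ.ν P (gOfRecord₁₀ F N θ P) k, σOfRecord F θ.ν θ.τ9.M P (gOfRecord₁₀ F N θ P) k s.init t ≠ s) :
    ¬ ∀ s, 0 < ∫ V, rterm (reprTOfRecord₁₀ F N θ P k) s V ∂(fieldMeasure (F.P P.K) (k + 1) (SU N)) := by
  rintro h
  obtain ⟨s, hs⟩ := hex
  have h1 := h s
  rw [rterm_reprTOfRecord₁₀_eq_zero_of_absent P k s hs] at h1
  simp at h1

/-- **… HENCE `Node00.WDisplays₁₀ θ λ P` IS UNINHABITED for EVERY layer `λ` whose step at `P` sits below an absent sequence** — every `WDisplays₁₀`-keyed N12 closer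
(g30's `b15Leaf_WOfRecord₁₀_of_displays`, this seat's p450999 ∕ p466877 §2, the `_of_displays` ∀-forms) is vacuous at such a (run, step).  LOCATED; count-neutral;
repaired by §3–§5. [cite: Balaban1989LargeFieldI, (0.2)–(0.3) p.176, p.176 ll.14–16; Balaban1988Convergent, (2.17)–(2.18) p.257 (bookkeeping census)] -/
theorem not_wDisplays₁₀_of_absent {lam : ResidW F N} (P : B12.RunParams)
    (hex : ∃ s : SeqOfRecord F θ.ν θ.τ9.M (gOfRecord₁₀ F N θ P) P.K (lam.kSel P + 1),
      ∀ t : LbOfRecord F θ.ν P (gOfRecord₁₀ F N θ P) (lam.kSel P), σOfRecord F θ.ν θ.τ9.M P (gOfRecord₁₀ F N θ P) (lam.kSel P) s.init t ≠ s) :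
    ¬ WDisplays₁₀ θ lam P :=
  fun hd => not_forall_mass_pos_of_absent P (lam.kSel P) hex hd.hmass

/-- **THE REPAIRED DISPLAY FAILS EXACTLY WHEN THE SELECTOR'S RANGE MEETS AN ABSENT SEQUENCE**: if some `ppSel s` is absent then `hmassSel : ∀ s, 0 < ∫dV t_{ppSel s}` is
false too — so at the IDENTITY selector (range = the whole index) the repair buys nothing; print's `Z ↦ Z″` lands on occurring small-field terms.  The bearing this census
records for NODE 00's choice of `θ.ppSel` (same species as K0′'s row P12). [cite: Balaban1989LargeFieldI, (0.3) p.176, p.177 (the selection of `Z″`); Balaban1988Convergent, (2.17)–(2.18) p.257 (bookkeeping census)] -/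
theorem not_forall_massSel_pos_of_absent_mem_range (P : B12.RunParams) (k : ℕ)
    (hex : ∃ s : SeqOfRecord F θ.ν θ.τ9.M (gOfRecord₁₀ F N θ P) P.K (k + 1),
      (∀ t : LbOfRecord F θ.ν P (gOfRecord₁₀ F N θ P) k, σOfRecord F θ.ν θ.τ9.M P (gOfRecord₁₀ F N θ P) k s.init t ≠ s) ∧
        s ∈ Set.range (θ.ppSel P (gOfRecord₁₀ F N θ P) (k + 1))) :
    ¬ ∀ s, 0 < ∫ V, rterm (reprTOfRecord₁₀ F N θ P k) (θ.ppSel P (gOfRecord₁₀ F N θ P) (k + 1) s) V ∂(fieldMeasure (F.P P.K) (k + 1) (SU N)) := by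
  rintro h
  obtain ⟨s, hs, ⟨s₀, rfl⟩⟩ := hex
  have h1 := h s₀
  rw [rterm_reprTOfRecord₁₀_eq_zero_of_absent P k _ hs] at h1
  simp at h1

end Absent

/-! ## §3 THE [IV] LEAF AT THE TRIPLY PINNED LAYER ON PRINT'S MASS PROVISO (Stage-9 generic; the ₁₂ records read `θ.toStage9Params`) -/

section PinnedLayer
variable {F : T4Family} {θ : Stage9Params F N} {lam : ResidW F N} (σ : ∀ P : B12.RunParams, Sit189 F N P.K)

/-- **THE [IV] LEAF AT `WOfRecord₁₀ θ ((λ.pinRPrime θ).pinD189 θ σ) P` ON THE DENOMINATOR-MASS PROVISO, EVERY RUN** — `N12ResidWPinnedLayer.b15Leaf_WOfRecord₁₀_pinAll_of_deg`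
with `hmass : ∀ s, 0 < ∫dV t_s` REPLACED by `hmassSel : ∀ s, 0 < ∫dV t_{ppSel s}` + the fibre witness `hfib` (n12-e's `b15Leaf_WOfRecord₁₀_of_massSel` below `K` — the term
provisos are the record's `rstep` there —, `…_of_massSel_supp` on the degenerate-run support provisos otherwise; (1.100) pin by `rfl`, (1.102) retired).  Displayed: Prop. 1
at `λ.LF P`, (1.80) at `σ.dev0` with the record's `ε_k ∕ η_k`, (1.89) at `D189OfRecord θ P (σ P)`. [cite: Balaban1989LargeFieldI, (0.2)–(0.6) p.176, p.176 ll.14–16, Prop. 1 (1.78) p.194, (1.80) p.195, (1.89) p.198, (1.99)–(1.102) pp.200–201] -/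
theorem b15Leaf_WOfRecord₁₀_pinAll_of_deg_massSel (hP : θ.Provisos₁₀) {P : B12.RunParams}
    (hdeg : P.K ≤ lam.kSel P →
      (repDataOfSel (repTOfRecord9 F N θ.ν θ.τ9 (EOfRecord₁₀ F N θ) (wOfRecord₉ F N θ) θ.ppSel P (gOfRecord₁₀ F N θ P) (lam.kSel P))
        (θ.ppSel P (gOfRecord₁₀ F N θ P) (lam.kSel P + 1)) (fibOfSeq F θ.ν θ.τ9 P (gOfRecord₁₀ F N θ P) (lam.kSel P + 1))).ProvisosSupp)
    (hmassSel : ∀ s, 0 < ∫ V, rterm (repTOfRecord9 F N θ.ν θ.τ9 (EOfRecord₁₀ F N θ) (wOfRecord₉ F N θ) θ.ppSel P (gOfRecord₁₀ F N θ P) (lam.kSel P))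
      (θ.ppSel P (gOfRecord₁₀ F N θ P) (lam.kSel P + 1) s) V ∂(fieldMeasure (F.P P.K) (lam.kSel P + 1) (SU N)))
    (hfib : ∀ s, ∃ s', θ.ppSel P (gOfRecord₁₀ F N θ P) (lam.kSel P + 1) s' = θ.ppSel P (gOfRecord₁₀ F N θ P) (lam.kSel P + 1) s ∧
      0 < ∫ V, rterm (repTOfRecord9 F N θ.ν θ.τ9 (EOfRecord₁₀ F N θ) (wOfRecord₉ F N θ) θ.ppSel P (gOfRecord₁₀ F N θ P) (lam.kSel P)) s' V
        ∂(fieldMeasure (F.P P.K) (lam.kSel P + 1) (SU N)))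
    (hP1 : Prop1Printed (lam.LF P))
    (h180 : ∀ U, new189 (D189OfRecord θ P (σ P)) U → ∀ i, (σ P).h ≤ i → i ≤ (σ P).k → ∀ q ∈ plaqsOf (dom (D189OfRecord θ P (σ P)) i),
      Ineq180 ((σ P).dev0 U.1 q) (epsOfRecord θ.ν (gOfRecord₁₀ F N θ P) (σ P).k) ((F.P P.K).eta (σ P).k) (σ P).B₃ (σ P).B₅ (σ P).M (σ P).δ ((σ P).dist q) (σ P).O1)
    (h189 : Claim189 (new189 (D189OfRecord θ P (σ P))) (chiPP (D189OfRecord θ P (σ P)))) :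
    B15Leaf (WOfRecord₁₀ F N θ ((lam.pinRPrime θ).pinD189 θ σ) P) := by
  rcases lt_or_ge (lam.kSel P) P.K with hK | hK
  · exact b15Leaf_WOfRecord₁₀_of_massSel (lam := (lam.pinRPrime θ).pinD189 θ σ) hP hK rfl hmassSel hfib hP1 h180 h189
  · exact b15Leaf_WOfRecord₁₀_of_massSel_supp (lam := (lam.pinRPrime θ).pinD189 θ σ) (hdeg hK) rfl hmassSel hfib hP1 h180 h189

/-- **CENSUS — at a JUNK situation (1.80) and (1.89) cost nothing** (the `σ` of `N12ResidWPinnedLayer.exists_sit189_not_new189`, `χ′ :≡ ⊥`): the leaf at the triply pinned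
layer from `θ.Provisos₁₀`, the degenerate-run support provisos, `hmassSel`, `hfib` and Proposition 1 ALONE.  LOCATED: the (1.89) situation must be the run's own.
[cite: Balaban1989LargeFieldI, (0.2)–(0.6) p.176, Prop. 1 (1.78) p.194, (1.80) p.195, (1.89) p.198, (1.82) p.196 (bookkeeping census)] -/
theorem b15Leaf_WOfRecord₁₀_pinAll_of_deg_massSel_of_not_new189 (hσ : ∀ (P : B12.RunParams) U, ¬ new189 (D189OfRecord θ P (σ P)) U) (hP : θ.Provisos₁₀)
    {P : B12.RunParams}
    (hdeg : P.K ≤ lam.kSel P →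
      (repDataOfSel (repTOfRecord9 F N θ.ν θ.τ9 (EOfRecord₁₀ F N θ) (wOfRecord₉ F N θ) θ.ppSel P (gOfRecord₁₀ F N θ P) (lam.kSel P))
        (θ.ppSel P (gOfRecord₁₀ F N θ P) (lam.kSel P + 1)) (fibOfSeq F θ.ν θ.τ9 P (gOfRecord₁₀ F N θ P) (lam.kSel P + 1))).ProvisosSupp)
    (hmassSel : ∀ s, 0 < ∫ V, rterm (repTOfRecord9 F N θ.ν θ.τ9 (EOfRecord₁₀ F N θ) (wOfRecord₉ F N θ) θ.ppSel P (gOfRecord₁₀ F N θ P) (lam.kSel P))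
      (θ.ppSel P (gOfRecord₁₀ F N θ P) (lam.kSel P + 1) s) V ∂(fieldMeasure (F.P P.K) (lam.kSel P + 1) (SU N)))
    (hfib : ∀ s, ∃ s', θ.ppSel P (gOfRecord₁₀ F N θ P) (lam.kSel P + 1) s' = θ.ppSel P (gOfRecord₁₀ F N θ P) (lam.kSel P + 1) s ∧
      0 < ∫ V, rterm (repTOfRecord9 F N θ.ν θ.τ9 (EOfRecord₁₀ F N θ) (wOfRecord₉ F N θ) θ.ppSel P (gOfRecord₁₀ F N θ P) (lam.kSel P)) s' V
        ∂(fieldMeasure (F.P P.K) (lam.kSel P + 1) (SU N)))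
    (hP1 : Prop1Printed (lam.LF P)) : B15Leaf (WOfRecord₁₀ F N θ ((lam.pinRPrime θ).pinD189 θ σ) P) :=
  b15Leaf_WOfRecord₁₀_pinAll_of_deg_massSel σ hP hdeg hmassSel hfib hP1 (fun U hU => (hσ P U hU).elim) (fun U hU => (hσ P U hU).elim)

/-- **CORNER — AT AN IDEMPOTENT SELECTOR THE FIBRE WITNESS IS FREE** (print's `Z″`: no passing components left, `(Z″)″ = Z″`; n12-e's `fibreWitness_of_idem`): the leaf
at the triply pinned layer from `θ.Provisos₁₀`, the degenerate-run support provisos, `hmassSel`, Proposition 1, (1.80), (1.89).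
[cite: Balaban1989LargeFieldI, (0.3) p.176, p.177, p.176 ll.14–16, Prop. 1 (1.78) p.194, (1.80) p.195, (1.89) p.198] -/
theorem b15Leaf_WOfRecord₁₀_pinAll_of_deg_massSel_of_idem (hP : θ.Provisos₁₀) {P : B12.RunParams}
    (hidem : ∀ s, θ.ppSel P (gOfRecord₁₀ F N θ P) (lam.kSel P + 1) (θ.ppSel P (gOfRecord₁₀ F N θ P) (lam.kSel P + 1) s)
      = θ.ppSel P (gOfRecord₁₀ F N θ P) (lam.kSel P + 1) s)
    (hdeg : P.K ≤ lam.kSel P →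
      (repDataOfSel (repTOfRecord9 F N θ.ν θ.τ9 (EOfRecord₁₀ F N θ) (wOfRecord₉ F N θ) θ.ppSel P (gOfRecord₁₀ F N θ P) (lam.kSel P))
        (θ.ppSel P (gOfRecord₁₀ F N θ P) (lam.kSel P + 1)) (fibOfSeq F θ.ν θ.τ9 P (gOfRecord₁₀ F N θ P) (lam.kSel P + 1))).ProvisosSupp)
    (hmassSel : ∀ s, 0 < ∫ V, rterm (repTOfRecord9 F N θ.ν θ.τ9 (EOfRecord₁₀ F N θ) (wOfRecord₉ F N θ) θ.ppSel P (gOfRecord₁₀ F N θ P) (lam.kSel P))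
      (θ.ppSel P (gOfRecord₁₀ F N θ P) (lam.kSel P + 1) s) V ∂(fieldMeasure (F.P P.K) (lam.kSel P + 1) (SU N)))
    (hP1 : Prop1Printed (lam.LF P))
    (h180 : ∀ U, new189 (D189OfRecord θ P (σ P)) U → ∀ i, (σ P).h ≤ i → i ≤ (σ P).k → ∀ q ∈ plaqsOf (dom (D189OfRecord θ P (σ P)) i),
      Ineq180 ((σ P).dev0 U.1 q) (epsOfRecord θ.ν (gOfRecord₁₀ F N θ P) (σ P).k) ((F.P P.K).eta (σ P).k) (σ P).B₃ (σ P).B₅ (σ P).M (σ P).δ ((σ P).dist q) (σ P).O1)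
    (h189 : Claim189 (new189 (D189OfRecord θ P (σ P))) (chiPP (D189OfRecord θ P (σ P)))) :
    B15Leaf (WOfRecord₁₀ F N θ ((lam.pinRPrime θ).pinD189 θ σ) P) :=
  b15Leaf_WOfRecord₁₀_pinAll_of_deg_massSel σ hP hdeg hmassSel
    (fibreWitness_of_idem (rterm (repTOfRecord9 F N θ.ν θ.τ9 (EOfRecord₁₀ F N θ) (wOfRecord₉ F N θ) θ.ppSel P (gOfRecord₁₀ F N θ P) (lam.kSel P))) _ hidem hmassSel)
    hP1 h180 h189

end PinnedLayer

/-! ## §4 THE STAGE-12 ∃-CURRENCY RE-CUT ON PRINT'S MASS PROVISO (the [IV] layer with all three letters pinned) -/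

section Currency
variable {F : T4Family}

/-- **A STAGE-12 RECORD WITH N12 AT EVERY RUN WHOSE [IV] LAYER HAS ALL THREE LETTERS PINNED, ON THE DENOMINATOR-MASS PROVISO** —
`N12AtRecord12ExistsCurrency.exists_world₁₂CB10YZW_b15_main_pinAll_of_mass` with `hmass` REPLACED by `hmassSel ∧ hfib` (so no longer vacuous at absent sequences, §2):
every admissible Stage-12 parameter with its provisos, any floor ∕ operator layer ∕ [B11] layer, window, step selector `k`, carrier family `L`, situation family `σ`
present a ₁₂CB10YZW record at a world whose [IV] layer `λ` has `λ.kSel = k`, `λ.LF = L`, is FIXED by both of the N12 s3 seat's pins, and where `Dag.B15_main` holds at EVERY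
run — from positive mass of the OCCURRING denominators + fibre witnesses (`hmassSel`, `hfib`), the degenerate-run support provisos (`hdeg`), Proposition 1 at `L` (`hL`),
(1.80) at `σ.dev0` (`h180`), (1.89) at `D189OfRecord θ₉ P (σ P)` (`h189`); (1.102) retired.  LOCATED; NOT a discharge. [cite: Balaban1989LargeFieldI, (0.2)–(0.6) p.176, p.176 ll.14–16, Prop. 1 (1.78) p.194, (1.80) p.195, (1.89) p.198, (1.99)–(1.102) pp.200–201; Balaban1989LargeFieldII, Thm 1 + (0.1) pp.355–356 (bookkeeping: the ∃-currency at the pinned letters)] -/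
theorem exists_world₁₂CB10YZW_b15_main_pinAll_of_massSel (θ : Stage12Params F N) (h : θ.Provisos₁₂ F N) (hθ : θ.Admissible F N) (Mstar : ℕ)
    (ops : OpsY N θ.toStage3Params Mstar) (ζ : ResidZ F N) {γw : ℝ} (hγw : 0 < γw ∧ γw ≤ θ.γ) (k : B12.RunParams → ℕ) (L : B12.RunParams → LFVar)
    (σ : ∀ P : B12.RunParams, Sit189 F N P.K) (hL : ∀ P, Prop1Printed (L P))
    (hmassSel : ∀ (P : B12.RunParams) s,
      0 < ∫ V, rterm (repTOfRecord9 F N θ.ν θ.τ9 (EOfRecord₁₀ F N θ.toStage9Params) (wOfRecord₉ F N θ.toStage9Params) θ.ppSel P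
        (gOfRecord₁₀ F N θ.toStage9Params P) (k P)) (θ.ppSel P (gOfRecord₁₀ F N θ.toStage9Params P) (k P + 1) s) V ∂(fieldMeasure (F.P P.K) (k P + 1) (SU N)))
    (hfib : ∀ (P : B12.RunParams) s, ∃ s', θ.ppSel P (gOfRecord₁₀ F N θ.toStage9Params P) (k P + 1) s' = θ.ppSel P (gOfRecord₁₀ F N θ.toStage9Params P) (k P + 1) s ∧
      0 < ∫ V, rterm (repTOfRecord9 F N θ.ν θ.τ9 (EOfRecord₁₀ F N θ.toStage9Params) (wOfRecord₉ F N θ.toStage9Params) θ.ppSel P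
        (gOfRecord₁₀ F N θ.toStage9Params P) (k P)) s' V ∂(fieldMeasure (F.P P.K) (k P + 1) (SU N)))
    (hdeg : ∀ P : B12.RunParams, P.K ≤ k P →
      (repDataOfSel (repTOfRecord9 F N θ.ν θ.τ9 (EOfRecord₁₀ F N θ.toStage9Params) (wOfRecord₉ F N θ.toStage9Params) θ.ppSel P
          (gOfRecord₁₀ F N θ.toStage9Params P) (k P))
        (θ.ppSel P (gOfRecord₁₀ F N θ.toStage9Params P) (k P + 1)) (fibOfSeq F θ.ν θ.τ9 P (gOfRecord₁₀ F N θ.toStage9Params P) (k P + 1))).ProvisosSupp)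
    (h180 : ∀ (P : B12.RunParams) U, new189 (D189OfRecord θ.toStage9Params P (σ P)) U → ∀ i, (σ P).h ≤ i → i ≤ (σ P).k →
      ∀ q ∈ plaqsOf (dom (D189OfRecord θ.toStage9Params P (σ P)) i),
        Ineq180 ((σ P).dev0 U.1 q) (epsOfRecord θ.ν (gOfRecord₁₀ F N θ.toStage9Params P) (σ P).k) ((F.P P.K).eta (σ P).k) (σ P).B₃ (σ P).B₅ (σ P).M (σ P).δ
          ((σ P).dist q) (σ P).O1)
    (h189 : ∀ P : B12.RunParams, Claim189 (new189 (D189OfRecord θ.toStage9Params P (σ P))) (chiPP (D189OfRecord θ.toStage9Params P (σ P)))) :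
    ∃ (lamW : ResidW F N) (w : WorldP), lamW.kSel = k ∧ lamW.LF = L ∧
      lamW.pinD189 θ.toStage9Params σ = lamW ∧ lamW.pinRPrime θ.toStage9Params = lamW ∧
      IsRecordOfRecord₁₂CB10YZW F N (datumOfRecord₁₂ F N θ h) w ∧ w.γ = γw ∧
      (∀ P, w.up P = upOfRecord₅C F N (θ.view₁₂B10YZW F N Mstar ops ζ lamW) P) ∧ ∀ P : B12.RunParams, Dag.B15_main (leavesP w P) := by
  obtain ⟨lam, hk, hLF, -⟩ := exists_residW_pinLF_printedDisplays θ.toStage9Params k L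
  subst hk hLF
  obtain ⟨w₀⟩ := nonempty_worldP
  refine ⟨(lam.pinRPrime θ.toStage9Params).pinD189 θ.toStage9Params σ, { w₀ with
      C := (datumOfRecord₁₂ F N θ h).C, γ := γw, L := (θ.L : ℝ), one_lt_L := by exact_mod_cast θ.hL.2,
      up := fun P => upOfRecord₅C F N (θ.view₁₂B10YZW F N Mstar ops ζ ((lam.pinRPrime θ.toStage9Params).pinD189 θ.toStage9Params σ)) P },
    rfl, rfl, rfl, rfl,
    ⟨θ, h, Mstar, ops, ζ, (lam.pinRPrime θ.toStage9Params).pinD189 θ.toStage9Params σ, hθ, rfl, rfl, hγw, rfl, fun _ => rfl⟩, rfl, fun _ => rfl, fun P => ?_⟩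
  refine b15_main_of_up_view₁₂B10YZW_of_leaf θ Mstar ops ζ ((lam.pinRPrime θ.toStage9Params).pinD189 θ.toStage9Params σ) rfl ?_
  exact b15Leaf_WOfRecord₁₀_pinAll_of_deg_massSel σ h.base (hdeg P) (hmassSel P) (hfib P) (hL P) (h180 P) (h189 P)

/-- **CENSUS (A2) — THE SAME RECORD AT A JUNK (1.89) SITUATION, ON THE DENOMINATOR-MASS PROVISO: (1.80) and (1.89) cost NOTHING** (`χ′ :≡ ⊥`; §3's
`…_of_not_new189`).  So even on print's mass proviso «all three letters pinned» is not yet «[IV] consumed»: the situation must be the run's own (`Sit189OfRecord` not in the tree).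
[cite: Balaban1989LargeFieldI, (0.2)–(0.6) p.176, Prop. 1 (1.78) p.194, (1.80) p.195, (1.89) p.198, (1.82) p.196; Balaban1989LargeFieldII, Thm 1 + (0.1) pp.355–356 (bookkeeping census)] -/
theorem exists_world₁₂CB10YZW_b15_main_pinAll_junkSit_of_massSel (θ : Stage12Params F N) (h : θ.Provisos₁₂ F N) (hθ : θ.Admissible F N) (Mstar : ℕ)
    (ops : OpsY N θ.toStage3Params Mstar) (ζ : ResidZ F N) {γw : ℝ} (hγw : 0 < γw ∧ γw ≤ θ.γ) (k : B12.RunParams → ℕ) (L : B12.RunParams → LFVar)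
    (hL : ∀ P, Prop1Printed (L P))
    (hmassSel : ∀ (P : B12.RunParams) s,
      0 < ∫ V, rterm (repTOfRecord9 F N θ.ν θ.τ9 (EOfRecord₁₀ F N θ.toStage9Params) (wOfRecord₉ F N θ.toStage9Params) θ.ppSel P
        (gOfRecord₁₀ F N θ.toStage9Params P) (k P)) (θ.ppSel P (gOfRecord₁₀ F N θ.toStage9Params P) (k P + 1) s) V ∂(fieldMeasure (F.P P.K) (k P + 1) (SU N)))
    (hfib : ∀ (P : B12.RunParams) s, ∃ s', θ.ppSel P (gOfRecord₁₀ F N θ.toStage9Params P) (k P + 1) s' = θ.ppSel P (gOfRecord₁₀ F N θ.toStage9Params P) (k P + 1) s ∧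
      0 < ∫ V, rterm (repTOfRecord9 F N θ.ν θ.τ9 (EOfRecord₁₀ F N θ.toStage9Params) (wOfRecord₉ F N θ.toStage9Params) θ.ppSel P
        (gOfRecord₁₀ F N θ.toStage9Params P) (k P)) s' V ∂(fieldMeasure (F.P P.K) (k P + 1) (SU N)))
    (hdeg : ∀ P : B12.RunParams, P.K ≤ k P →
      (repDataOfSel (repTOfRecord9 F N θ.ν θ.τ9 (EOfRecord₁₀ F N θ.toStage9Params) (wOfRecord₉ F N θ.toStage9Params) θ.ppSel P
          (gOfRecord₁₀ F N θ.toStage9Params P) (k P))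
        (θ.ppSel P (gOfRecord₁₀ F N θ.toStage9Params P) (k P + 1)) (fibOfSeq F θ.ν θ.τ9 P (gOfRecord₁₀ F N θ.toStage9Params P) (k P + 1))).ProvisosSupp) :
    ∃ (σ : ∀ P : B12.RunParams, Sit189 F N P.K) (lamW : ResidW F N) (w : WorldP), lamW.kSel = k ∧ lamW.LF = L ∧
      lamW.pinD189 θ.toStage9Params σ = lamW ∧ lamW.pinRPrime θ.toStage9Params = lamW ∧
      IsRecordOfRecord₁₂CB10YZW F N (datumOfRecord₁₂ F N θ h) w ∧ w.γ = γw ∧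
      (∀ P, w.up P = upOfRecord₅C F N (θ.view₁₂B10YZW F N Mstar ops ζ lamW) P) ∧ ∀ P : B12.RunParams, Dag.B15_main (leavesP w P) := by
  obtain ⟨σ, hσ⟩ := exists_sit189_not_new189 N F
  obtain ⟨lamW, w, hk, hLF, hpin1, hpin2, hrec, hγ, hup, hN⟩ := exists_world₁₂CB10YZW_b15_main_pinAll_of_massSel θ h hθ Mstar ops ζ hγw k L σ hL hmassSel hfib hdeg
    (fun P U hU => (hσ θ.toStage9Params P U hU).elim) (fun P U hU => (hσ θ.toStage9Params P U hU).elim)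
  exact ⟨σ, lamW, w, hk, hLF, hpin1, hpin2, hrec, hγ, hup, hN⟩

/-- **`S_N12 Rec` AT RECORDS WHOSE HIDDEN [IV] LAYERS ARE TRIPLY PINNED, DEGENERATE-RUN FORM, ON THE DENOMINATOR-MASS PROVISO** — the ∀-form closer
`N12AtRecord12ExistsCurrency.s_N12_of_refines₁₂CB10YZW_of_pinAll_deg` with `hmass ↦ hmassSel ∧ hfib` (§1's leaf socket ∘ §3).  NOT-A-DISCHARGE.
[cite: Balaban1989LargeFieldI, Prop. 1 (1.78) p.194, (0.2)–(0.6) p.176, p.176 ll.14–16, (1.80) p.195, (1.89) p.198, (1.99)–(1.102) pp.200–201; Balaban1989LargeFieldII, Thm 1 + (0.1) pp.355–356 (bookkeeping)] -/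
theorem s_N12_of_refines₁₂CB10YZW_of_pinAll_deg_massSel (Rec : RecordPred N)
    (href : ∀ (F : T4Family) (D : Datum F N) (w : WorldP), Rec F D w → IsRecordOfRecord₁₂CB10YZW F N D w)
    (hyp : ∀ (F : T4Family) (D : Datum F N) (w : WorldP), Rec F D w →
      ∀ (θ : Stage12Params F N) (hP : θ.Provisos₁₂ F N) (Mstar : ℕ) (ops : OpsY N θ.toStage3Params Mstar) (ζ : ResidZ F N) (lamW : ResidW F N),
        θ.Admissible F N → D = datumOfRecord₁₂ F N θ hP → (∀ P, w.up P = upOfRecord₅C F N (θ.view₁₂B10YZW F N Mstar ops ζ lamW) P) →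
          ∃ (lam₀ : ResidW F N) (σ : ∀ P : B12.RunParams, Sit189 F N P.K),
            lamW = (lam₀.pinRPrime θ.toStage9Params).pinD189 θ.toStage9Params σ ∧ ∀ P : B12.RunParams,
              (P.K ≤ lam₀.kSel P →
                (repDataOfSel (repTOfRecord9 F N θ.ν θ.τ9 (EOfRecord₁₀ F N θ.toStage9Params) (wOfRecord₉ F N θ.toStage9Params) θ.ppSel P
                    (gOfRecord₁₀ F N θ.toStage9Params P) (lam₀.kSel P))
                  (θ.ppSel P (gOfRecord₁₀ F N θ.toStage9Params P) (lam₀.kSel P + 1))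
                  (fibOfSeq F θ.ν θ.τ9 P (gOfRecord₁₀ F N θ.toStage9Params P) (lam₀.kSel P + 1))).ProvisosSupp) ∧
              (∀ s, 0 < ∫ V, rterm (repTOfRecord9 F N θ.ν θ.τ9 (EOfRecord₁₀ F N θ.toStage9Params) (wOfRecord₉ F N θ.toStage9Params) θ.ppSel P
                (gOfRecord₁₀ F N θ.toStage9Params P) (lam₀.kSel P)) (θ.ppSel P (gOfRecord₁₀ F N θ.toStage9Params P) (lam₀.kSel P + 1) s) V
                  ∂(fieldMeasure (F.P P.K) (lam₀.kSel P + 1) (SU N))) ∧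
              (∀ s, ∃ s', θ.ppSel P (gOfRecord₁₀ F N θ.toStage9Params P) (lam₀.kSel P + 1) s'
                  = θ.ppSel P (gOfRecord₁₀ F N θ.toStage9Params P) (lam₀.kSel P + 1) s ∧
                0 < ∫ V, rterm (repTOfRecord9 F N θ.ν θ.τ9 (EOfRecord₁₀ F N θ.toStage9Params) (wOfRecord₉ F N θ.toStage9Params) θ.ppSel P
                  (gOfRecord₁₀ F N θ.toStage9Params P) (lam₀.kSel P)) s' V ∂(fieldMeasure (F.P P.K) (lam₀.kSel P + 1) (SU N))) ∧
              Prop1Printed (lam₀.LF P) ∧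
              (∀ U, new189 (D189OfRecord θ.toStage9Params P (σ P)) U → ∀ i, (σ P).h ≤ i → i ≤ (σ P).k →
                ∀ q ∈ plaqsOf (dom (D189OfRecord θ.toStage9Params P (σ P)) i),
                  Ineq180 ((σ P).dev0 U.1 q) (epsOfRecord θ.ν (gOfRecord₁₀ F N θ.toStage9Params P) (σ P).k) ((F.P P.K).eta (σ P).k) (σ P).B₃ (σ P).B₅ (σ P).M
                    (σ P).δ ((σ P).dist q) (σ P).O1) ∧
              Claim189 (new189 (D189OfRecord θ.toStage9Params P (σ P))) (chiPP (D189OfRecord θ.toStage9Params P (σ P)))) :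
    S_N12 Rec :=
  s_N12_of_refines₁₂CB10YZW_of_leaf Rec href (fun F D w hR θ hP Mstar ops ζ lamW hθ hD hup P => by
    obtain ⟨lam₀, σ, hl, h⟩ := hyp F D w hR θ hP Mstar ops ζ lamW hθ hD hup
    obtain ⟨hdeg, hmassSel, hfib, hP1, h180, h189⟩ := h P
    rw [hl]
    exact b15Leaf_WOfRecord₁₀_pinAll_of_deg_massSel σ hP.base hdeg hmassSel hfib hP1 h180 h189)

end Currency

/-! ## §5 IN `stub_nodes12`'s CURRENCY — the same world, keyed on def-T's `IsRecordOfRecord₁₂C`, with the package exposed for the other nodes' closers -/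

section StubCurrency
variable {F : T4Family}

/-- **A ₁₂C RECORD OF THE GIVEN TUPLE'S DATUM WITH N12 AT EVERY RUN, ON THE DENOMINATOR-MASS PROVISO** — §4's world read in the currency of plan g64's registered stub
`stub_nodes12 : Inhabited12 F → NodesAtSomeRecord12 F` (`K1Skeleton12`, keyed on `Node00.IsRecordOfRecord₁₂C`; g32's refinement `isRecordOfRecord₁₂C_of_isRecordOfRecord₁₂CB10YZW`):
for the SAME `θ` the stub destructures (its unity guard `θ.ZtUnity ∧ θ.SlotsNondegenerate` rides on `θ` untouched), its provisos `h`, ANY floor `Mstar`, operator layer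
`ops`, [B11] layer `ζ` and window, the world `w` of `datumOfRecord₁₂ θ h` with `w.up P = upOfRecord₅C (θ.view₁₂B10YZW Mstar ops ζ λ) P` — so the other twelve nodes'
pointed closers apply AT THIS `w` — carries `Dag.B15_main` at every run, given `hmassSel`, `hfib`, `hdeg` (NODE 00), `hL` (Proposition 1 at the pinned carrier), `h180`,
`h189` (at the N12 s3 seat's letters).  The N12 conjunct of `NodesAtSomeRecord12`, displayed; NOT the stub, NOT a discharge. [cite: Balaban1989LargeFieldI, (0.2)–(0.6) p.176, p.176 ll.14–16, Prop. 1 (1.78) p.194, (1.80) p.195, (1.89) p.198, (1.99)–(1.102) pp.200–201; Balaban1989LargeFieldII, Thm 1 + (0.1) pp.355–356 (bookkeeping: the stub's currency)] -/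
theorem exists_world₁₂C_b15_main_pinAll_of_massSel (θ : Stage12Params F N) (h : θ.Provisos₁₂ F N) (hθ : θ.Admissible F N) (Mstar : ℕ)
    (ops : OpsY N θ.toStage3Params Mstar) (ζ : ResidZ F N) {γw : ℝ} (hγw : 0 < γw ∧ γw ≤ θ.γ) (k : B12.RunParams → ℕ) (L : B12.RunParams → LFVar)
    (σ : ∀ P : B12.RunParams, Sit189 F N P.K) (hL : ∀ P, Prop1Printed (L P))
    (hmassSel : ∀ (P : B12.RunParams) s,
      0 < ∫ V, rterm (repTOfRecord9 F N θ.ν θ.τ9 (EOfRecord₁₀ F N θ.toStage9Params) (wOfRecord₉ F N θ.toStage9Params) θ.ppSel P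
        (gOfRecord₁₀ F N θ.toStage9Params P) (k P)) (θ.ppSel P (gOfRecord₁₀ F N θ.toStage9Params P) (k P + 1) s) V ∂(fieldMeasure (F.P P.K) (k P + 1) (SU N)))
    (hfib : ∀ (P : B12.RunParams) s, ∃ s', θ.ppSel P (gOfRecord₁₀ F N θ.toStage9Params P) (k P + 1) s' = θ.ppSel P (gOfRecord₁₀ F N θ.toStage9Params P) (k P + 1) s ∧
      0 < ∫ V, rterm (repTOfRecord9 F N θ.ν θ.τ9 (EOfRecord₁₀ F N θ.toStage9Params) (wOfRecord₉ F N θ.toStage9Params) θ.ppSel P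
        (gOfRecord₁₀ F N θ.toStage9Params P) (k P)) s' V ∂(fieldMeasure (F.P P.K) (k P + 1) (SU N)))
    (hdeg : ∀ P : B12.RunParams, P.K ≤ k P →
      (repDataOfSel (repTOfRecord9 F N θ.ν θ.τ9 (EOfRecord₁₀ F N θ.toStage9Params) (wOfRecord₉ F N θ.toStage9Params) θ.ppSel P
          (gOfRecord₁₀ F N θ.toStage9Params P) (k P))
        (θ.ppSel P (gOfRecord₁₀ F N θ.toStage9Params P) (k P + 1)) (fibOfSeq F θ.ν θ.τ9 P (gOfRecord₁₀ F N θ.toStage9Params P) (k P + 1))).ProvisosSupp)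
    (h180 : ∀ (P : B12.RunParams) U, new189 (D189OfRecord θ.toStage9Params P (σ P)) U → ∀ i, (σ P).h ≤ i → i ≤ (σ P).k →
      ∀ q ∈ plaqsOf (dom (D189OfRecord θ.toStage9Params P (σ P)) i),
        Ineq180 ((σ P).dev0 U.1 q) (epsOfRecord θ.ν (gOfRecord₁₀ F N θ.toStage9Params P) (σ P).k) ((F.P P.K).eta (σ P).k) (σ P).B₃ (σ P).B₅ (σ P).M (σ P).δ
          ((σ P).dist q) (σ P).O1)
    (h189 : ∀ P : B12.RunParams, Claim189 (new189 (D189OfRecord θ.toStage9Params P (σ P))) (chiPP (D189OfRecord θ.toStage9Params P (σ P)))) :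
    ∃ (lamW : ResidW F N) (w : WorldP), lamW.kSel = k ∧ lamW.LF = L ∧
      lamW.pinD189 θ.toStage9Params σ = lamW ∧ lamW.pinRPrime θ.toStage9Params = lamW ∧
      IsRecordOfRecord₁₂C F N (datumOfRecord₁₂ F N θ h) w ∧ w.γ = γw ∧
      (∀ P, w.up P = upOfRecord₅C F N (θ.view₁₂B10YZW F N Mstar ops ζ lamW) P) ∧ ∀ P : B12.RunParams, Dag.B15_main (leavesP w P) := by
  obtain ⟨lamW, w, hk, hLF, hpin1, hpin2, hrec, hγ, hup, hN⟩ :=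
    exists_world₁₂CB10YZW_b15_main_pinAll_of_massSel θ h hθ Mstar ops ζ hγw k L σ hL hmassSel hfib hdeg h180 h189
  exact ⟨lamW, w, hk, hLF, hpin1, hpin2, isRecordOfRecord₁₂C_of_isRecordOfRecord₁₂CB10YZW hrec, hγ, hup, hN⟩

end StubCurrency

end Summit.QuantumFields.YangMills.BalabanUVNodes.N12AtRecord12MassSel

end
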